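import Literature.Analysis.SegalBargmann.HermiteMatrixTempered
import Literature.Analysis.SegalBargmann.HermiteBlockOperators
import Literature.Analysis.SegalBargmann.SchwartzTorusIdentification
import HarnessLib

/-!
# Tempered Hermite matrices are exactly the continuous operators on `𝓢(ℝⁿ)` (operator form of Reed–Simon V.13; Folland 1989, §1.7)

Topic `Analysis/SegalBargmann`; namespace `Literature.Analysis.SegalBargmann`.  The `N`-representation theorem
(`HermiteExpansionSchwartz`, `HermiteCoefficientDecay`, `HermiteSeminormGrowth`) identifies `𝓢(ℝ^σ, ℂ)` with the space `s` of
rapidly decreasing Hermite-coefficient families.  `HermiteMatrixTempered` proved one half of the resulting description of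
the continuous operators: the Hermite matrix `a(α, β) := c_α(A h_β)` of a continuous `A : 𝓢 →L 𝓢` is TEMPERED — for every
`m` there are `k, C` with `Σ_α (|α|+1)^m ‖a(α, β)‖ ≤ C (|β|+1)^k`.  This file proves the converse and closes the loop:

* §1 `IsTemperedKernel u` (the summed temperedness condition, exactly the conclusion of
  `exists_tsum_degree_pow_mul_norm_hermiteCoeff_apply_herm_le`), its equivalence with the ENTRYWISE bounds
  `(|α|+1)^m ‖u(α,β)‖ ≤ C_m (|β|+1)^{k_m}` (`isTemperedKernel_iff_entrywise`, trading `n+2` powers for the summable weight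
  of `HermiteCoefficientDecay`); every degree-block kernel of polynomial growth (`IsBlockKernel`, `HermiteBlockOperators`)
  is tempered;
* §2 the MATRIX COEFFICIENT `w_α(f) := Σ_β u(α,β) c_β(f)` (`matrixCoeff`; an absolutely convergent series) and the key
  Fubini estimate `Σ_α (|α|+1)^m ‖w_α(f)‖ ≤ C · Q_k(f)` (`Q_k = coeffMass k`, the weighted coefficient mass of
  `HermiteBlockOperators`), by interchanging a non-negative double series (Mathlib `summable_prod_of_nonneg`);
* §3 the operator `T_u f := Σ_α w_α(f) h_α` (`hermiteMatrixCLM u hu : 𝓢 →L[ℂ] 𝓢`, the series converging in `𝓢`), with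
  `c_α(T_u f) = w_α(f)`, `c_α(T_u h_β) = u(α,β)` (the kernel IS the Hermite matrix of `T_u`), `T_u h_β = Σ_α u(α,β) h_α`,
  continuity seminorm by seminorm (`exists_seminorm_hermiteMatrixCLM_le_sup_seminorm`), consistency with the block operators
  (`hermiteMatrixCLM_eq_hermiteBlockCLM`);
* §4 the MATRIX REPRESENTATION THEOREM: every continuous `A : 𝓢 →L[ℂ] 𝓢` is the operator of its own Hermite matrix,
  `A = hermiteMatrixCLM (clmKernel A) _` (`hermiteMatrixCLM_clmKernel`; density of the Hermite span in operator form,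
  `clm_eq_of_eq_on_herm`), and `c_α(A f) = Σ_β c_α(A h_β) c_β(f)` for every Schwartz `f` (`hermiteCoeff_clm_apply`); two
  continuous operators with the same Hermite matrix are equal.

Everything is proved from Mathlib and the imported tree files; no cited statement is used as a hypothesis.  Use
(pub-hodgecm node W2-⊗ (⊗S), route (s2), piece P3): the coefficient-space form of continuous operators, in which the tensor
product of two operators on `𝓢(ℝ^{σ₁}) , 𝓢(ℝ^{σ₂})` is defined by the product kernel (sequel `SchwartzTensorOperators`).

## References

* [ReedSimonI1980] M. Reed, B. Simon, *Methods of Modern Mathematical Physics I*, Appendix to §V.3, Theorem V.13 (the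
  `N`-representation theorem: `f ↦ (c_α(f))_α` is a topological isomorphism `𝒮(ℝ^k) ≅ s_k`, the Hermite expansion converges
  in `𝒮`) [corpus:book:reed1972-methods-modern-mathematical-physics-i-iv-i p0133 L27].  The description of the continuous
  operators by tempered matrices proved in this file is the OPERATOR FORM of V.13 (a linear self-map of `s_k` is continuous
  iff every seminorm of the image is dominated by finitely many seminorms of the argument); it is proved here, not cited.
  [cite: ReedSimonI1980, Thm V.13]
* [Folland1989] G. B. Folland, *Harmonic Analysis in Phase Space*, Princeton UP (1989), §1.7. [cite: Folland1989, §1.7]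

## Provenance

LEAN-IN-TREE rule (2026-08-18), pub-hodgecm model-construction sub-cell; node W2-⊗, (⊗S) archimedean half, piece P3 of the
design recorded by seat mc-binder-2 gen 2 (`HANDOFF-g2.md` §6), written by seat pv08 gen 20.
-/

set_option autoImplicit false

noncomputable section

open Complex SchwartzMap MeasureTheory Filter Topology
open scoped BigOperators Real NNReal

namespace Literature.Analysis.SegalBargmann

variable {σ : Type*} [Fintype σ] [DecidableEq σ]

/-! ## §1  Tempered kernels -/

section Kernel

/-- **A tempered kernel** `u : ℕ^σ × ℕ^σ → ℂ`: for every `m` the columns `α ↦ (|α|+1)^m ‖u(α,β)‖` are summable and their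
sums grow at most polynomially in `β`, `Σ_α (|α|+1)^m ‖u(α,β)‖ ≤ C_m (|β|+1)^{k_m}`.  This is the (summed form of the)
temperedness of Reed–Simon's Theorem V.13 / its Appendix: exactly the property of the Hermite matrix of a continuous operator
on `𝓢(ℝ^σ)` (`isTemperedKernel_clmKernel`). [cite: ReedSimonI1980, Thm V.13] -/
structure IsTemperedKernel (u : (σ →₀ ℕ) → (σ →₀ ℕ) → ℂ) : Prop where
  summable : ∀ (m : ℕ) (β : σ →₀ ℕ), Summable fun α : σ →₀ ℕ => ((α.degree : ℝ) + 1) ^ m * ‖u α β‖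
  tsum_le : ∀ m : ℕ, ∃ (k : ℕ) (C : ℝ), 0 ≤ C ∧ ∀ β : σ →₀ ℕ,
    ∑' α : σ →₀ ℕ, ((α.degree : ℝ) + 1) ^ m * ‖u α β‖ ≤ C * ((β.degree : ℝ) + 1) ^ k

variable {u : (σ →₀ ℕ) → (σ →₀ ℕ) → ℂ}

omit [Fintype σ] [DecidableEq σ] in
/-- **Entrywise temperedness**: `(|α|+1)^m ‖u(α,β)‖ ≤ C_m (|β|+1)^{k_m}` for all `α, β`. [folklore] -/
theorem IsTemperedKernel.exists_degree_pow_mul_norm_le (hu : IsTemperedKernel u) (m : ℕ) :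
    ∃ (k : ℕ) (C : ℝ), 0 ≤ C ∧ ∀ α β : σ →₀ ℕ,
      ((α.degree : ℝ) + 1) ^ m * ‖u α β‖ ≤ C * ((β.degree : ℝ) + 1) ^ k := by
  obtain ⟨k, C, hC0, h⟩ := hu.tsum_le m
  refine ⟨k, C, hC0, fun α β => le_trans ?_ (h β)⟩
  exact (hu.summable m β).le_tsum α fun γ _ => by positivity

omit [Fintype σ] [DecidableEq σ] in
/-- In particular the entries are polynomially bounded in `β` uniformly in `α`: `‖u(α,β)‖ ≤ C (|β|+1)^k`. [folklore] -/
theorem IsTemperedKernel.exists_norm_le (hu : IsTemperedKernel u) :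
    ∃ (k : ℕ) (C : ℝ), 0 ≤ C ∧ ∀ α β : σ →₀ ℕ, ‖u α β‖ ≤ C * ((β.degree : ℝ) + 1) ^ k := by
  obtain ⟨k, C, hC0, h⟩ := hu.exists_degree_pow_mul_norm_le 0
  refine ⟨k, C, hC0, fun α β => ?_⟩
  have h1 := h α β
  rwa [pow_zero, one_mul] at h1

omit [DecidableEq σ] in
/-- **Entrywise ⇒ summed temperedness**: if for every `m` there are `k, C` with `(|α|+1)^m ‖u(α,β)‖ ≤ C (|β|+1)^k`
for all `α, β`, then `u` is tempered — trade `n + 2` powers of `(|α|+1)` (`n = card σ`) for the summable weight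
`Σ_α (|α|+1)^{-(n+2)}` (`summable_inv_degree_add_one_pow`).  This is the form in which product kernels are checked
(`SchwartzTensorOperators`). [folklore] -/
theorem IsTemperedKernel.of_entrywise
    (h : ∀ m : ℕ, ∃ (k : ℕ) (C : ℝ), 0 ≤ C ∧ ∀ α β : σ →₀ ℕ,
      ((α.degree : ℝ) + 1) ^ m * ‖u α β‖ ≤ C * ((β.degree : ℝ) + 1) ^ k) :
    IsTemperedKernel u := by
  have hW := summable_inv_degree_add_one_pow (σ := σ)
  have hW0 : 0 ≤ ∑' α : σ →₀ ℕ, (((α.degree : ℝ) + 1) ^ (Fintype.card σ + 2))⁻¹ :=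
    tsum_nonneg fun α => by positivity
  -- domination of the `m`-th weighted column by the summable weight
  have hdom : ∀ m : ℕ, ∃ (k : ℕ) (C : ℝ), 0 ≤ C ∧ ∀ α β : σ →₀ ℕ,
      ((α.degree : ℝ) + 1) ^ m * ‖u α β‖ ≤
        C * ((β.degree : ℝ) + 1) ^ k * (((α.degree : ℝ) + 1) ^ (Fintype.card σ + 2))⁻¹ := fun m => by
    obtain ⟨k, C, hC0, hC⟩ := h (m + (Fintype.card σ + 2))
    refine ⟨k, C, hC0, fun α β => ?_⟩
    have hpos : 0 < ((α.degree : ℝ) + 1) ^ (Fintype.card σ + 2) := by positivity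
    have key : ((α.degree : ℝ) + 1) ^ m * ‖u α β‖ * ((α.degree : ℝ) + 1) ^ (Fintype.card σ + 2) ≤
        C * ((β.degree : ℝ) + 1) ^ k := by
      have h1 := hC α β
      rw [pow_add] at h1
      calc ((α.degree : ℝ) + 1) ^ m * ‖u α β‖ * ((α.degree : ℝ) + 1) ^ (Fintype.card σ + 2)
          = ((α.degree : ℝ) + 1) ^ m * ((α.degree : ℝ) + 1) ^ (Fintype.card σ + 2) * ‖u α β‖ := by ring
        _ ≤ C * ((β.degree : ℝ) + 1) ^ k := h1
    calc ((α.degree : ℝ) + 1) ^ m * ‖u α β‖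
        = ((α.degree : ℝ) + 1) ^ m * ‖u α β‖ * ((α.degree : ℝ) + 1) ^ (Fintype.card σ + 2) *
            (((α.degree : ℝ) + 1) ^ (Fintype.card σ + 2))⁻¹ := (mul_inv_cancel_right₀ hpos.ne' _).symm
      _ ≤ C * ((β.degree : ℝ) + 1) ^ k * (((α.degree : ℝ) + 1) ^ (Fintype.card σ + 2))⁻¹ :=
          mul_le_mul_of_nonneg_right key (by positivity)
  refine ⟨fun m β => ?_, fun m => ?_⟩
  · obtain ⟨k, C, hC0, hC⟩ := hdom m
    exact Summable.of_nonneg_of_le (fun α => by positivity) (fun α => hC α β)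
      (hW.mul_left (C * ((β.degree : ℝ) + 1) ^ k))
  · obtain ⟨k, C, hC0, hC⟩ := hdom m
    refine ⟨k, C * ∑' α : σ →₀ ℕ, (((α.degree : ℝ) + 1) ^ (Fintype.card σ + 2))⁻¹, mul_nonneg hC0 hW0, fun β => ?_⟩
    have hs : Summable fun α : σ →₀ ℕ =>
        C * ((β.degree : ℝ) + 1) ^ k * (((α.degree : ℝ) + 1) ^ (Fintype.card σ + 2))⁻¹ := hW.mul_left _
    calc ∑' α : σ →₀ ℕ, ((α.degree : ℝ) + 1) ^ m * ‖u α β‖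
        ≤ ∑' α : σ →₀ ℕ, C * ((β.degree : ℝ) + 1) ^ k * (((α.degree : ℝ) + 1) ^ (Fintype.card σ + 2))⁻¹ :=
          Summable.tsum_le_tsum (fun α => hC α β)
            (Summable.of_nonneg_of_le (fun α => by positivity) (fun α => hC α β) hs) hs
      _ = C * (∑' α : σ →₀ ℕ, (((α.degree : ℝ) + 1) ^ (Fintype.card σ + 2))⁻¹) * ((β.degree : ℝ) + 1) ^ k := by
          rw [tsum_mul_left]; ring

omit [DecidableEq σ] in
/-- **Tempered ⇔ entrywise tempered.** [folklore] -/
theorem isTemperedKernel_iff_entrywise :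
    IsTemperedKernel u ↔ ∀ m : ℕ, ∃ (k : ℕ) (C : ℝ), 0 ≤ C ∧ ∀ α β : σ →₀ ℕ,
      ((α.degree : ℝ) + 1) ^ m * ‖u α β‖ ≤ C * ((β.degree : ℝ) + 1) ^ k :=
  ⟨fun hu => hu.exists_degree_pow_mul_norm_le, IsTemperedKernel.of_entrywise⟩

omit [Fintype σ] [DecidableEq σ] in
/-- The zero kernel is tempered. [folklore] -/
theorem isTemperedKernel_zero : IsTemperedKernel (0 : (σ →₀ ℕ) → (σ →₀ ℕ) → ℂ) where
  summable _ _ := by simp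
  tsum_le _ := ⟨0, 0, le_rfl, fun β => by simp⟩

omit [DecidableEq σ] in
/-- **Degree-block kernels of polynomial growth are tempered**: for `IsBlockKernel u a M` the column of `β` is supported
in the finite block `{|α| = |β|}` (at most `(|β|+1)^n` entries, `card_degLE_le`), so
`Σ_α (|α|+1)^m ‖u(α,β)‖ ≤ M (|β|+1)^{m+a+n}`. [folklore] -/
theorem IsBlockKernel.isTemperedKernel {a : ℕ} {M : ℝ} (hu : IsBlockKernel u a M) : IsTemperedKernel u := by
  have hM := hu.nonneg
  -- the column of `β` vanishes outside `degLE |β|`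
  have hzero : ∀ (m : ℕ) (β α : σ →₀ ℕ), α ∉ (degLE β.degree : Finset (σ →₀ ℕ)) →
      ((α.degree : ℝ) + 1) ^ m * ‖u α β‖ = 0 := fun m β α hα => by
    rw [mem_degLE_iff_degree_le, not_le] at hα
    rw [hu.eq_zero α β (by omega), norm_zero, mul_zero]
  have hsum : ∀ (m : ℕ) (β : σ →₀ ℕ), Summable fun α : σ →₀ ℕ => ((α.degree : ℝ) + 1) ^ m * ‖u α β‖ :=
    fun m β => summable_of_ne_finset_zero (hzero m β)
  refine ⟨hsum, fun m => ⟨m + a + Fintype.card σ, M, hM, fun β => ?_⟩⟩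
  rw [tsum_eq_sum (hzero m β)]
  -- each entry of the block is `≤ (|β|+1)^m · M (|β|+1)^a`
  have hterm : ∀ α ∈ (degLE β.degree : Finset (σ →₀ ℕ)),
      ((α.degree : ℝ) + 1) ^ m * ‖u α β‖ ≤ M * ((β.degree : ℝ) + 1) ^ (m + a) := fun α hα => by
    by_cases h : α.degree = β.degree
    · rw [h, pow_add]
      calc ((β.degree : ℝ) + 1) ^ m * ‖u α β‖
          ≤ ((β.degree : ℝ) + 1) ^ m * (M * ((β.degree : ℝ) + 1) ^ a) :=
            mul_le_mul_of_nonneg_left (hu.norm_le α β) (by positivity)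
        _ = M * (((β.degree : ℝ) + 1) ^ m * ((β.degree : ℝ) + 1) ^ a) := by ring
    · rw [hu.eq_zero α β h, norm_zero, mul_zero]
      positivity
  refine (Finset.sum_le_card_nsmul _ _ _ hterm).trans ?_
  rw [nsmul_eq_mul]
  have hcard : ((degLE β.degree : Finset (σ →₀ ℕ)).card : ℝ) ≤ ((β.degree : ℝ) + 1) ^ Fintype.card σ := by
    exact_mod_cast card_degLE_le (σ := σ) β.degree
  calc ((degLE β.degree : Finset (σ →₀ ℕ)).card : ℝ) * (M * ((β.degree : ℝ) + 1) ^ (m + a))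
      ≤ ((β.degree : ℝ) + 1) ^ Fintype.card σ * (M * ((β.degree : ℝ) + 1) ^ (m + a)) :=
        mul_le_mul_of_nonneg_right hcard (by positivity)
    _ = M * ((β.degree : ℝ) + 1) ^ (m + a + Fintype.card σ) := by rw [pow_add _ (m + a)]; ring

end Kernel

/-! ## §2  The matrix coefficient `w_α(f) = Σ_β u(α,β) c_β(f)` and the Fubini estimate -/

section Coeff

variable {u : (σ →₀ ℕ) → (σ →₀ ℕ) → ℂ}

variable (u) in
/-- **The matrix coefficient** `w_α(f) := Σ_β u(α,β) c_β(f)` (an absolutely convergent series for a tempered kernel and a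
Schwartz `f`, `IsTemperedKernel.summable_entry_mul_hermiteCoeff`). [folklore] -/
def matrixCoeff (f : 𝓢(EuclideanSpace ℝ σ, ℂ)) (α : σ →₀ ℕ) : ℂ :=
  ∑' β : σ →₀ ℕ, u α β * hermiteCoeff β f

variable (u) in
/-- Unfolding: `w_α(f) = Σ' β, u(α,β) c_β(f)`. [folklore] -/
theorem matrixCoeff_apply (f : 𝓢(EuclideanSpace ℝ σ, ℂ)) (α : σ →₀ ℕ) :
    matrixCoeff u f α = ∑' β : σ →₀ ℕ, u α β * hermiteCoeff β f := rfl

/-- The terms of `w_α(f)` are absolutely summable: `Σ_β ‖u(α,β)‖ ‖c_β(f)‖ < ∞` (entries of polynomial growth against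
rapidly decreasing coefficients). [folklore] -/
theorem IsTemperedKernel.summable_norm_entry_mul_norm_hermiteCoeff (hu : IsTemperedKernel u)
    (f : 𝓢(EuclideanSpace ℝ σ, ℂ)) (α : σ →₀ ℕ) :
    Summable fun β : σ →₀ ℕ => ‖u α β‖ * ‖hermiteCoeff β f‖ := by
  obtain ⟨k, C, hC0, h⟩ := hu.exists_norm_le
  refine ((summable_degree_pow_mul_norm_hermiteCoeff k f).mul_left C).of_nonneg_of_le
    (fun β => by positivity) fun β => ?_
  calc ‖u α β‖ * ‖hermiteCoeff β f‖ ≤ C * ((β.degree : ℝ) + 1) ^ k * ‖hermiteCoeff β f‖ :=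
        mul_le_mul_of_nonneg_right (h α β) (norm_nonneg _)
    _ = C * (((β.degree : ℝ) + 1) ^ k * ‖hermiteCoeff β f‖) := by ring

/-- The series defining `w_α(f)` converges (absolutely). [folklore] -/
theorem IsTemperedKernel.summable_entry_mul_hermiteCoeff (hu : IsTemperedKernel u) (f : 𝓢(EuclideanSpace ℝ σ, ℂ))
    (α : σ →₀ ℕ) : Summable fun β : σ →₀ ℕ => u α β * hermiteCoeff β f :=
  .of_norm_bounded (hu.summable_norm_entry_mul_norm_hermiteCoeff f α) fun _ => norm_mul_le _ _

/-- `‖w_α(f)‖ ≤ Σ_β ‖u(α,β)‖ ‖c_β(f)‖`. [folklore] -/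
theorem IsTemperedKernel.norm_matrixCoeff_le (hu : IsTemperedKernel u) (f : 𝓢(EuclideanSpace ℝ σ, ℂ)) (α : σ →₀ ℕ) :
    ‖matrixCoeff u f α‖ ≤ ∑' β : σ →₀ ℕ, ‖u α β‖ * ‖hermiteCoeff β f‖ := by
  refine (norm_tsum_le_tsum_norm ?_).trans (le_of_eq (tsum_congr fun β => norm_mul _ _))
  simpa only [norm_mul] using hu.summable_norm_entry_mul_norm_hermiteCoeff f α

/-- `w_α(f + g) = w_α(f) + w_α(g)`. [folklore] -/
theorem IsTemperedKernel.matrixCoeff_add (hu : IsTemperedKernel u) (f g : 𝓢(EuclideanSpace ℝ σ, ℂ)) (α : σ →₀ ℕ) :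
    matrixCoeff u (f + g) α = matrixCoeff u f α + matrixCoeff u g α := by
  rw [matrixCoeff, matrixCoeff, matrixCoeff, ← (hu.summable_entry_mul_hermiteCoeff f α).tsum_add
    (hu.summable_entry_mul_hermiteCoeff g α)]
  exact tsum_congr fun β => by rw [hermiteCoeff_add, mul_add]

/-- `w_α(c f) = c w_α(f)`. [folklore] -/
theorem matrixCoeff_smul (u : (σ →₀ ℕ) → (σ →₀ ℕ) → ℂ) (c : ℂ) (f : 𝓢(EuclideanSpace ℝ σ, ℂ)) (α : σ →₀ ℕ) :
    matrixCoeff u (c • f) α = c * matrixCoeff u f α := by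
  rw [matrixCoeff, matrixCoeff, ← tsum_mul_left]
  exact tsum_congr fun β => by rw [hermiteCoeff_smul]; ring

/-- **The matrix coefficient of a basis vector is the matrix entry**: `w_α(h_β) = u(α,β)`. [folklore] -/
theorem matrixCoeff_herm (u : (σ →₀ ℕ) → (σ →₀ ℕ) → ℂ) (α β : σ →₀ ℕ) :
    matrixCoeff u (hermiteSchwartz (herm β)) α = u α β := by
  rw [matrixCoeff]
  simp_rw [hermiteCoeff_herm]
  rw [tsum_eq_single β (fun γ hγ => by rw [if_neg hγ, mul_zero]), if_pos rfl, mul_one]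

omit [Fintype σ] [DecidableEq σ] in
/-- **Tonelli for a non-negative double family** (bookkeeping): if `F ≥ 0`, every row `F i` is summable with
`Σ_j F i j ≤ g i` and `g` is summable, then every column is summable, the column sums are summable, and
`Σ_j Σ_i F i j ≤ Σ_i g i` (Mathlib `summable_prod_of_nonneg`, `Summable.tsum_comm`). [folklore] -/
theorem tonelli_tsum_tsum_le {ι κ : Type*} {F : ι → κ → ℝ} (hF0 : ∀ i j, 0 ≤ F i j) (hrow : ∀ i, Summable (F i))
    {g : ι → ℝ} (hg : Summable g) (hle : ∀ i, ∑' j, F i j ≤ g i) :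
    (Summable fun j => ∑' i, F i j) ∧ (∀ j, Summable fun i => F i j) ∧
      ∑' j, ∑' i, F i j ≤ ∑' i, g i := by
  have hU : Summable (Function.uncurry F) := by
    refine (summable_prod_of_nonneg fun q => hF0 q.1 q.2).2 ⟨fun i => hrow i, ?_⟩
    exact Summable.of_nonneg_of_le (fun i => tsum_nonneg fun j => hF0 i j) hle hg
  refine ⟨hU.prod_symm.prod, fun j => hU.prod_symm.prod_factor j, ?_⟩
  rw [hU.tsum_comm]
  exact Summable.tsum_le_tsum hle hU.prod hg

/-- **The Fubini estimate** (the heart of the matter): if `Σ_α (|α|+1)^m ‖u(α,β)‖ ≤ C (|β|+1)^k` for all `β`, then for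
every Schwartz `f` the weighted coefficient family `α ↦ (|α|+1)^m ‖w_α(f)‖` is summable and
`Σ_α (|α|+1)^m ‖w_α(f)‖ ≤ C · Q_k(f)`, `Q_k(f) = Σ_β (|β|+1)^k ‖c_β(f)‖` — Tonelli for the non-negative double series
`Σ_β Σ_α (|α|+1)^m ‖u(α,β)‖ ‖c_β(f)‖` (`tonelli_tsum_tsum_le`). [folklore] -/
theorem IsTemperedKernel.summable_and_tsum_degree_pow_mul_norm_matrixCoeff_le (hu : IsTemperedKernel u) {m k : ℕ}
    {C : ℝ} (hC : ∀ β : σ →₀ ℕ, ∑' α : σ →₀ ℕ, ((α.degree : ℝ) + 1) ^ m * ‖u α β‖ ≤ C * ((β.degree : ℝ) + 1) ^ k)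
    (f : 𝓢(EuclideanSpace ℝ σ, ℂ)) :
    (Summable fun α : σ →₀ ℕ => ((α.degree : ℝ) + 1) ^ m * ‖matrixCoeff u f α‖) ∧
      ∑' α : σ →₀ ℕ, ((α.degree : ℝ) + 1) ^ m * ‖matrixCoeff u f α‖ ≤ C * coeffMass k f := by
  -- Tonelli for `F β α := (|α|+1)^m ‖u(α,β)‖ ‖c_β(f)‖ ≥ 0`, rows bounded by `g β := C (|β|+1)^k ‖c_β(f)‖`
  have hrow : ∀ β : σ →₀ ℕ,
      Summable fun α : σ →₀ ℕ => ((α.degree : ℝ) + 1) ^ m * ‖u α β‖ * ‖hermiteCoeff β f‖ := fun β =>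
    (hu.summable m β).mul_right _
  have hle : ∀ β : σ →₀ ℕ, ∑' α : σ →₀ ℕ, ((α.degree : ℝ) + 1) ^ m * ‖u α β‖ * ‖hermiteCoeff β f‖ ≤
      C * (((β.degree : ℝ) + 1) ^ k * ‖hermiteCoeff β f‖) := fun β => by
    rw [tsum_mul_right, ← mul_assoc]
    exact mul_le_mul_of_nonneg_right (hC β) (norm_nonneg _)
  obtain ⟨hcol, hcolβ, hsum⟩ := tonelli_tsum_tsum_le (F := fun (β α : σ →₀ ℕ) =>
      ((α.degree : ℝ) + 1) ^ m * ‖u α β‖ * ‖hermiteCoeff β f‖) (fun β α => by positivity) hrow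
    ((summable_degree_pow_mul_norm_hermiteCoeff k f).mul_left C) hle
  -- pointwise: `(|α|+1)^m ‖w_α(f)‖ ≤ Σ_β F β α`
  have hpt : ∀ α : σ →₀ ℕ, ((α.degree : ℝ) + 1) ^ m * ‖matrixCoeff u f α‖ ≤
      ∑' β : σ →₀ ℕ, ((α.degree : ℝ) + 1) ^ m * ‖u α β‖ * ‖hermiteCoeff β f‖ := fun α => by
    simp_rw [mul_assoc]
    rw [tsum_mul_left]
    exact mul_le_mul_of_nonneg_left (hu.norm_matrixCoeff_le f α) (by positivity)
  have hS : Summable fun α : σ →₀ ℕ => ((α.degree : ℝ) + 1) ^ m * ‖matrixCoeff u f α‖ :=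
    Summable.of_nonneg_of_le (fun α => by positivity) hpt hcol
  refine ⟨hS, (Summable.tsum_le_tsum hpt hS hcol).trans (hsum.trans (le_of_eq ?_))⟩
  rw [tsum_mul_left]
  rfl

/-- **Summability of the weighted matrix coefficients** against every power of the degree. [folklore] -/
theorem IsTemperedKernel.summable_degree_pow_mul_norm_matrixCoeff (hu : IsTemperedKernel u) (m : ℕ)
    (f : 𝓢(EuclideanSpace ℝ σ, ℂ)) :
    Summable fun α : σ →₀ ℕ => ((α.degree : ℝ) + 1) ^ m * ‖matrixCoeff u f α‖ := by
  obtain ⟨k, C, -, hC⟩ := hu.tsum_le m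
  exact (hu.summable_and_tsum_degree_pow_mul_norm_matrixCoeff_le hC f).1

/-- **The weighted sum bound**: `Σ_α (|α|+1)^m ‖w_α(f)‖ ≤ C Q_k(f)` whenever `Σ_α (|α|+1)^m ‖u(α,β)‖ ≤ C (|β|+1)^k`.
[folklore] -/
theorem IsTemperedKernel.tsum_degree_pow_mul_norm_matrixCoeff_le (hu : IsTemperedKernel u) {m k : ℕ} {C : ℝ}
    (hC : ∀ β : σ →₀ ℕ, ∑' α : σ →₀ ℕ, ((α.degree : ℝ) + 1) ^ m * ‖u α β‖ ≤ C * ((β.degree : ℝ) + 1) ^ k)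
    (f : 𝓢(EuclideanSpace ℝ σ, ℂ)) :
    ∑' α : σ →₀ ℕ, ((α.degree : ℝ) + 1) ^ m * ‖matrixCoeff u f α‖ ≤ C * coeffMass k f :=
  (hu.summable_and_tsum_degree_pow_mul_norm_matrixCoeff_le hC f).2

end Coeff

/-! ## §3  The operator `T_u` of a tempered kernel -/

section Operator

variable {u : (σ →₀ ℕ) → (σ →₀ ℕ) → ℂ}

variable (u) in
/-- **The operator `T_u f = Σ_α w_α(f) h_α`** of a tempered kernel, as a linear map on `𝒮(ℝ^σ, ℂ)` (the series converges in
`𝒮`, `summable_smul_hermiteSchwartz_herm`). [cite: ReedSimonI1980, Thm V.13] -/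
def hermiteMatrixₗ (hu : IsTemperedKernel u) : 𝓢(EuclideanSpace ℝ σ, ℂ) →ₗ[ℂ] 𝓢(EuclideanSpace ℝ σ, ℂ) where
  toFun f := ∑' α : σ →₀ ℕ, matrixCoeff u f α • hermiteSchwartz (herm α)
  map_add' f g := by
    have hf := summable_smul_hermiteSchwartz_herm (hu.summable_degree_pow_mul_norm_matrixCoeff · f)
    have hg := summable_smul_hermiteSchwartz_herm (hu.summable_degree_pow_mul_norm_matrixCoeff · g)
    rw [← hf.tsum_add hg]
    congr 1
    funext α
    rw [hu.matrixCoeff_add, add_smul]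
  map_smul' c f := by
    have hf := summable_smul_hermiteSchwartz_herm (hu.summable_degree_pow_mul_norm_matrixCoeff · f)
    rw [RingHom.id_apply, ← hf.tsum_const_smul c]
    congr 1
    funext α
    rw [matrixCoeff_smul, smul_smul]

/-- Unfolding. [folklore] -/
theorem hermiteMatrixₗ_apply (hu : IsTemperedKernel u) (f : 𝓢(EuclideanSpace ℝ σ, ℂ)) :
    hermiteMatrixₗ u hu f = ∑' α : σ →₀ ℕ, matrixCoeff u f α • hermiteSchwartz (herm α) := rfl

/-- The defining series: `Σ_α w_α(f) h_α = T_u f` in `𝒮(ℝ^σ)`. [folklore] -/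
theorem hasSum_hermiteMatrixₗ (hu : IsTemperedKernel u) (f : 𝓢(EuclideanSpace ℝ σ, ℂ)) :
    HasSum (fun α : σ →₀ ℕ => matrixCoeff u f α • hermiteSchwartz (herm α)) (hermiteMatrixₗ u hu f) := by
  rw [hermiteMatrixₗ_apply]
  exact (summable_smul_hermiteSchwartz_herm (hu.summable_degree_pow_mul_norm_matrixCoeff · f)).hasSum

/-- **`c_α(T_u f) = w_α(f)`.** [folklore] -/
theorem hermiteCoeff_hermiteMatrixₗ (hu : IsTemperedKernel u) (f : 𝓢(EuclideanSpace ℝ σ, ℂ)) (α : σ →₀ ℕ) :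
    hermiteCoeff α (hermiteMatrixₗ u hu f) = matrixCoeff u f α :=
  hermiteCoeff_of_hasSum (hasSum_hermiteMatrixₗ hu f) α

/-- **Seminorm bounds for `T_u`**: for every `(k,l)` there are finitely many Schwartz seminorms `s` and `C ≥ 0` with
`p_{k,l}(T_u f) ≤ C · (s.sup p)(f)` for all `f`. [cite: ReedSimonI1980, Thm V.13] -/
theorem exists_seminorm_hermiteMatrixₗ_le_sup_seminorm (hu : IsTemperedKernel u) (k l : ℕ) :
    ∃ (s : Finset (ℕ × ℕ)) (C : ℝ), 0 ≤ C ∧ ∀ f : 𝓢(EuclideanSpace ℝ σ, ℂ),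
      SchwartzMap.seminorm ℂ k l (hermiteMatrixₗ u hu f) ≤
        C * (s.sup (schwartzSeminormFamily ℂ (EuclideanSpace ℝ σ) ℂ)) f := by
  obtain ⟨C, hC0, hC⟩ := exists_seminorm_hermiteSchwartz_herm_le (σ := σ) k l
  obtain ⟨K, Cu, hCu0, hCu⟩ := hu.tsum_le (k + l + Fintype.card σ + 1)
  obtain ⟨s, C', hC'0, hC'⟩ := exists_coeffMass_le_sup_seminorm (σ := σ) K
  refine ⟨s, C * Cu * C', by positivity, fun f => ?_⟩
  have e1 := seminorm_le_of_hasSum hC0 hC (hasSum_hermiteMatrixₗ hu f)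
    (hu.summable_degree_pow_mul_norm_matrixCoeff (k + l + Fintype.card σ + 1) f)
  have e2 := hu.tsum_degree_pow_mul_norm_matrixCoeff_le hCu f
  calc SchwartzMap.seminorm ℂ k l (hermiteMatrixₗ u hu f)
      ≤ C * ∑' α : σ →₀ ℕ, ((α.degree : ℝ) + 1) ^ (k + l + Fintype.card σ + 1) * ‖matrixCoeff u f α‖ := e1
    _ ≤ C * (Cu * coeffMass K f) := by gcongr
    _ ≤ C * (Cu * (C' * (s.sup (schwartzSeminormFamily ℂ (EuclideanSpace ℝ σ) ℂ)) f)) := by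
        gcongr
        exact hC' f
    _ = C * Cu * C' * (s.sup (schwartzSeminormFamily ℂ (EuclideanSpace ℝ σ) ℂ)) f := by ring

/-- **`T_u` is continuous on `𝒮(ℝ^σ, ℂ)`.** [cite: ReedSimonI1980, Thm V.13] -/
theorem continuous_hermiteMatrixₗ (hu : IsTemperedKernel u) : Continuous (hermiteMatrixₗ u hu) := by
  have hW := schwartz_withSeminorms ℂ (EuclideanSpace ℝ σ) ℂ
  refine WithSeminorms.continuous_of_isBounded hW hW (hermiteMatrixₗ u hu)
    (Seminorm.IsBounded.of_real fun i => ?_)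
  obtain ⟨k, l⟩ := i
  obtain ⟨s, C, -, h⟩ := exists_seminorm_hermiteMatrixₗ_le_sup_seminorm hu k l
  exact ⟨s, C, fun f => h f⟩

variable (u) in
/-- **The operator `T_u : 𝒮(ℝ^σ, ℂ) →L[ℂ] 𝒮(ℝ^σ, ℂ)`** of a tempered kernel `u` (Reed–Simon V.13: tempered matrices act
continuously on `s ≅ 𝒮`). [cite: ReedSimonI1980, Thm V.13] -/
def hermiteMatrixCLM (hu : IsTemperedKernel u) : 𝓢(EuclideanSpace ℝ σ, ℂ) →L[ℂ] 𝓢(EuclideanSpace ℝ σ, ℂ) :=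
  ⟨hermiteMatrixₗ u hu, continuous_hermiteMatrixₗ hu⟩

/-- Unfolding. [folklore] -/
theorem hermiteMatrixCLM_apply (hu : IsTemperedKernel u) (f : 𝓢(EuclideanSpace ℝ σ, ℂ)) :
    hermiteMatrixCLM u hu f = ∑' α : σ →₀ ℕ, matrixCoeff u f α • hermiteSchwartz (herm α) := rfl

/-- `Σ_α w_α(f) h_α = T_u f` in `𝒮(ℝ^σ)`. [folklore] -/
theorem hasSum_hermiteMatrixCLM (hu : IsTemperedKernel u) (f : 𝓢(EuclideanSpace ℝ σ, ℂ)) :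
    HasSum (fun α : σ →₀ ℕ => matrixCoeff u f α • hermiteSchwartz (herm α)) (hermiteMatrixCLM u hu f) :=
  hasSum_hermiteMatrixₗ hu f

/-- **`c_α(T_u f) = w_α(f) = Σ_β u(α,β) c_β(f)`.** [cite: ReedSimonI1980, Thm V.13] -/
theorem hermiteCoeff_hermiteMatrixCLM (hu : IsTemperedKernel u) (f : 𝓢(EuclideanSpace ℝ σ, ℂ)) (α : σ →₀ ℕ) :
    hermiteCoeff α (hermiteMatrixCLM u hu f) = matrixCoeff u f α :=
  hermiteCoeff_hermiteMatrixₗ hu f α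

/-- **`c_α(T_u f) = Σ' β, u(α,β) c_β(f)`**, the coefficient formula with the series written out (the form consumed
by the tensor-product construction `SchwartzTensorOperators`). [cite: ReedSimonI1980, Thm V.13] -/
theorem hermiteCoeff_hermiteMatrixCLM_eq_tsum (hu : IsTemperedKernel u) (f : 𝓢(EuclideanSpace ℝ σ, ℂ)) (α : σ →₀ ℕ) :
    hermiteCoeff α (hermiteMatrixCLM u hu f) = ∑' β : σ →₀ ℕ, u α β * hermiteCoeff β f :=
  hermiteCoeff_hermiteMatrixₗ hu f α

/-- The `HasSum` form of the coefficient formula: `Σ_β u(α,β) c_β(f) = c_α(T_u f)`. [folklore] -/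
theorem hasSum_entry_mul_hermiteCoeff (hu : IsTemperedKernel u) (f : 𝓢(EuclideanSpace ℝ σ, ℂ)) (α : σ →₀ ℕ) :
    HasSum (fun β : σ →₀ ℕ => u α β * hermiteCoeff β f) (hermiteCoeff α (hermiteMatrixCLM u hu f)) := by
  rw [hermiteCoeff_hermiteMatrixCLM]
  exact (hu.summable_entry_mul_hermiteCoeff f α).hasSum

/-- The seminorm bound for `hermiteMatrixCLM`. [folklore] -/
theorem exists_seminorm_hermiteMatrixCLM_le_sup_seminorm (hu : IsTemperedKernel u) (k l : ℕ) :
    ∃ (s : Finset (ℕ × ℕ)) (C : ℝ), 0 ≤ C ∧ ∀ f : 𝓢(EuclideanSpace ℝ σ, ℂ),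
      SchwartzMap.seminorm ℂ k l (hermiteMatrixCLM u hu f) ≤
        C * (s.sup (schwartzSeminormFamily ℂ (EuclideanSpace ℝ σ) ℂ)) f :=
  exists_seminorm_hermiteMatrixₗ_le_sup_seminorm hu k l

/-- **`c_α(T_u h_β) = u(α,β)`**: the kernel is the Hermite matrix of `T_u`. [cite: ReedSimonI1980, Thm V.13] -/
theorem hermiteCoeff_hermiteMatrixCLM_herm (hu : IsTemperedKernel u) (α β : σ →₀ ℕ) :
    hermiteCoeff α (hermiteMatrixCLM u hu (hermiteSchwartz (herm β))) = u α β := by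
  rw [hermiteCoeff_hermiteMatrixCLM, matrixCoeff_herm]

/-- **Action on the basis**: `T_u h_β = Σ_α u(α,β) h_α`, the `β`-th column summed in `𝒮(ℝ^σ)`. [folklore] -/
theorem hasSum_hermiteMatrixCLM_herm (hu : IsTemperedKernel u) (β : σ →₀ ℕ) :
    HasSum (fun α : σ →₀ ℕ => u α β • hermiteSchwartz (herm (σ := σ) α))
      (hermiteMatrixCLM u hu (hermiteSchwartz (herm β))) := by
  have h := hasSum_hermiteMatrixCLM hu (hermiteSchwartz (herm β))
  simp_rw [matrixCoeff_herm] at h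
  exact h

/-- `T_u h_β = Σ' α, u(α,β) h_α`. [folklore] -/
theorem hermiteMatrixCLM_herm (hu : IsTemperedKernel u) (β : σ →₀ ℕ) :
    hermiteMatrixCLM u hu (hermiteSchwartz (herm β)) = ∑' α : σ →₀ ℕ, u α β • hermiteSchwartz (herm (σ := σ) α) :=
  (hasSum_hermiteMatrixCLM_herm hu β).tsum_eq.symm

/-- **Two tempered kernels with the same entries give the same operator** (proof-irrelevance of the temperedness
witness, stated for rewriting). [folklore] -/
theorem hermiteMatrixCLM_congr {u' : (σ →₀ ℕ) → (σ →₀ ℕ) → ℂ} (hu : IsTemperedKernel u) (hu' : IsTemperedKernel u')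
    (h : ∀ α β, u α β = u' α β) : hermiteMatrixCLM u hu = hermiteMatrixCLM u' hu' := by
  obtain rfl : u = u' := funext fun α => funext fun β => h α β
  rfl

/-- **Consistency with the degree-block operators**: for a block kernel of polynomial growth the operator of the (tempered)
kernel is the block operator `hermiteBlockCLM` of `HermiteBlockOperators`. [folklore] -/
theorem hermiteMatrixCLM_eq_hermiteBlockCLM {a : ℕ} {M : ℝ} (hu : IsBlockKernel u a M) :
    hermiteMatrixCLM u hu.isTemperedKernel = hermiteBlockCLM u hu := by
  refine clm_eq_of_eq_on_herm fun β => ext_hermiteCoeff fun α => ?_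
  rw [hermiteCoeff_hermiteMatrixCLM_herm, hermiteCoeff_hermiteBlockCLM_herm hu]

/-- In particular the Hermite multipliers are matrix operators: `T_{diag m} = hermiteMultiplierCLM m`. [folklore] -/
theorem hermiteMatrixCLM_diagonal {m : (σ →₀ ℕ) → ℂ} {a : ℕ} {M : ℝ} (hm : IsPolyBounded m a M)
    (f : 𝓢(EuclideanSpace ℝ σ, ℂ)) :
    hermiteMatrixCLM (diagonalKernel m) (isBlockKernel_diagonalKernel hm).isTemperedKernel f =
      hermiteMultiplierCLM m hm f := by
  rw [hermiteMatrixCLM_eq_hermiteBlockCLM (isBlockKernel_diagonalKernel hm), hermiteBlockCLM_diagonal]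

end Operator

/-! ## §4  The matrix representation theorem -/

section Representation

/-- **The Hermite matrix of a continuous operator**: `clmKernel A (α, β) := c_α(A h_β)`. [cite: ReedSimonI1980, Thm V.13] -/
def clmKernel (A : 𝓢(EuclideanSpace ℝ σ, ℂ) →L[ℂ] 𝓢(EuclideanSpace ℝ σ, ℂ)) (α β : σ →₀ ℕ) : ℂ :=
  hermiteCoeff α (A (hermiteSchwartz (herm β)))

/-- Unfolding. [folklore] -/
theorem clmKernel_apply (A : 𝓢(EuclideanSpace ℝ σ, ℂ) →L[ℂ] 𝓢(EuclideanSpace ℝ σ, ℂ)) (α β : σ →₀ ℕ) :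
    clmKernel A α β = hermiteCoeff α (A (hermiteSchwartz (herm β))) := rfl

/-- **The Hermite matrix of a continuous operator is a tempered kernel** (`HermiteMatrixTempered`).
[cite: ReedSimonI1980, Thm V.13] -/
theorem isTemperedKernel_clmKernel (A : 𝓢(EuclideanSpace ℝ σ, ℂ) →L[ℂ] 𝓢(EuclideanSpace ℝ σ, ℂ)) :
    IsTemperedKernel (clmKernel A) where
  summable m β := summable_degree_pow_mul_norm_hermiteCoeff m (A (hermiteSchwartz (herm β)))
  tsum_le m := exists_tsum_degree_pow_mul_norm_hermiteCoeff_apply_herm_le A m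

/-- The Hermite matrix of `T_u` is `u`. [folklore] -/
theorem clmKernel_hermiteMatrixCLM {u : (σ →₀ ℕ) → (σ →₀ ℕ) → ℂ} (hu : IsTemperedKernel u) :
    clmKernel (hermiteMatrixCLM u hu) = u :=
  funext fun α => funext fun β => hermiteCoeff_hermiteMatrixCLM_herm hu α β

/-- **THE MATRIX REPRESENTATION THEOREM**: every continuous operator on `𝒮(ℝ^σ, ℂ)` is the operator of its Hermite matrix,
`A = T_{clmKernel A}` (the two continuous maps agree on every `h_β`, `clm_eq_of_eq_on_herm`).  Together with
`isTemperedKernel_clmKernel` and `clmKernel_hermiteMatrixCLM`: continuous operators on `𝒮(ℝ^σ)` ↔ tempered kernels.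
[cite: ReedSimonI1980, Thm V.13] -/
theorem hermiteMatrixCLM_clmKernel (A : 𝓢(EuclideanSpace ℝ σ, ℂ) →L[ℂ] 𝓢(EuclideanSpace ℝ σ, ℂ)) :
    hermiteMatrixCLM (clmKernel A) (isTemperedKernel_clmKernel A) = A := by
  refine clm_eq_of_eq_on_herm fun β => ext_hermiteCoeff fun α => ?_
  rw [hermiteCoeff_hermiteMatrixCLM_herm, clmKernel_apply]

/-- **Coefficient formula for a continuous operator**: `c_α(A f) = Σ_β c_α(A h_β) c_β(f)`, absolutely convergent, for every
Schwartz `f`. [cite: ReedSimonI1980, Thm V.13] -/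
theorem hasSum_clmKernel_mul_hermiteCoeff (A : 𝓢(EuclideanSpace ℝ σ, ℂ) →L[ℂ] 𝓢(EuclideanSpace ℝ σ, ℂ))
    (f : 𝓢(EuclideanSpace ℝ σ, ℂ)) (α : σ →₀ ℕ) :
    HasSum (fun β : σ →₀ ℕ => clmKernel A α β * hermiteCoeff β f) (hermiteCoeff α (A f)) := by
  have h := hasSum_entry_mul_hermiteCoeff (isTemperedKernel_clmKernel A) f α
  rwa [hermiteMatrixCLM_clmKernel] at h

/-- `c_α(A f) = Σ' β, c_α(A h_β) c_β(f)`. [cite: ReedSimonI1980, Thm V.13] -/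
theorem hermiteCoeff_clm_apply (A : 𝓢(EuclideanSpace ℝ σ, ℂ) →L[ℂ] 𝓢(EuclideanSpace ℝ σ, ℂ))
    (f : 𝓢(EuclideanSpace ℝ σ, ℂ)) (α : σ →₀ ℕ) :
    hermiteCoeff α (A f) = ∑' β : σ →₀ ℕ, clmKernel A α β * hermiteCoeff β f :=
  (hasSum_clmKernel_mul_hermiteCoeff A f α).tsum_eq.symm

/-- The columns of a continuous operator: `A h_β = Σ_α c_α(A h_β) h_α` in `𝒮(ℝ^σ)`. [folklore] -/
theorem hasSum_clmKernel_smul_herm (A : 𝓢(EuclideanSpace ℝ σ, ℂ) →L[ℂ] 𝓢(EuclideanSpace ℝ σ, ℂ)) (β : σ →₀ ℕ) :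
    HasSum (fun α : σ →₀ ℕ => clmKernel A α β • hermiteSchwartz (herm (σ := σ) α)) (A (hermiteSchwartz (herm β))) :=
  hasSum_hermiteCoeff_smul_herm _

/-- **A continuous operator on `𝒮(ℝ^σ)` is determined by its Hermite matrix.** [cite: ReedSimonI1980, Thm V.13] -/
theorem clm_eq_of_clmKernel_eq {A B : 𝓢(EuclideanSpace ℝ σ, ℂ) →L[ℂ] 𝓢(EuclideanSpace ℝ σ, ℂ)}
    (h : ∀ α β : σ →₀ ℕ, clmKernel A α β = clmKernel B α β) : A = B := by
  rw [← hermiteMatrixCLM_clmKernel A, ← hermiteMatrixCLM_clmKernel B]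
  exact hermiteMatrixCLM_congr _ _ h

/-- **Uniqueness**: a continuous operator whose Hermite matrix is the tempered kernel `u` IS `T_u`. [folklore] -/
theorem eq_hermiteMatrixCLM_of_hermiteCoeff_apply_herm {u : (σ →₀ ℕ) → (σ →₀ ℕ) → ℂ} (hu : IsTemperedKernel u)
    (B : 𝓢(EuclideanSpace ℝ σ, ℂ) →L[ℂ] 𝓢(EuclideanSpace ℝ σ, ℂ))
    (h : ∀ α β : σ →₀ ℕ, hermiteCoeff α (B (hermiteSchwartz (herm β))) = u α β) : B = hermiteMatrixCLM u hu :=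
  clm_eq_of_clmKernel_eq fun α β => by rw [clmKernel_apply, h, clmKernel_hermiteMatrixCLM]

/-- **Existence and uniqueness packaged**: for a tempered kernel `u` there is exactly one continuous operator on
`𝒮(ℝ^σ, ℂ)` with Hermite matrix `u`. [cite: ReedSimonI1980, Thm V.13] -/
theorem existsUnique_clm_hermiteCoeff_apply_herm_eq {u : (σ →₀ ℕ) → (σ →₀ ℕ) → ℂ} (hu : IsTemperedKernel u) :
    ∃! B : 𝓢(EuclideanSpace ℝ σ, ℂ) →L[ℂ] 𝓢(EuclideanSpace ℝ σ, ℂ),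
      ∀ α β : σ →₀ ℕ, hermiteCoeff α (B (hermiteSchwartz (herm β))) = u α β :=
  ⟨hermiteMatrixCLM u hu, hermiteCoeff_hermiteMatrixCLM_herm hu,
    fun B hB => eq_hermiteMatrixCLM_of_hermiteCoeff_apply_herm hu B hB⟩

/-- The Hermite matrix of a composite is the matrix product: `c_α(A B h_β) = Σ_γ c_α(A h_γ) c_γ(B h_β)`. [folklore] -/
theorem clmKernel_comp (A B : 𝓢(EuclideanSpace ℝ σ, ℂ) →L[ℂ] 𝓢(EuclideanSpace ℝ σ, ℂ)) (α β : σ →₀ ℕ) :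
    clmKernel (A.comp B) α β = ∑' γ : σ →₀ ℕ, clmKernel A α γ * clmKernel B γ β := by
  rw [clmKernel_apply, ContinuousLinearMap.comp_apply, hermiteCoeff_clm_apply]
  rfl

/-- The Hermite matrix of the identity is the Kronecker delta. [folklore] -/
theorem clmKernel_id (α β : σ →₀ ℕ) :
    clmKernel (ContinuousLinearMap.id ℂ (𝓢(EuclideanSpace ℝ σ, ℂ))) α β = if α = β then 1 else 0 := by
  rw [clmKernel_apply, ContinuousLinearMap.id_apply, hermiteCoeff_herm]

/-- The Hermite matrix is linear in the operator: sums. [folklore] -/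
theorem clmKernel_add (A B : 𝓢(EuclideanSpace ℝ σ, ℂ) →L[ℂ] 𝓢(EuclideanSpace ℝ σ, ℂ)) (α β : σ →₀ ℕ) :
    clmKernel (A + B) α β = clmKernel A α β + clmKernel B α β := by
  rw [clmKernel_apply, clmKernel_apply, clmKernel_apply, ← hermiteCoeff_add]
  rfl

/-- The Hermite matrix is linear in the operator: scalars. [folklore] -/
theorem clmKernel_smul (c : ℂ) (A : 𝓢(EuclideanSpace ℝ σ, ℂ) →L[ℂ] 𝓢(EuclideanSpace ℝ σ, ℂ)) (α β : σ →₀ ℕ) :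
    clmKernel (c • A) α β = c * clmKernel A α β := by
  rw [clmKernel_apply, clmKernel_apply, ← hermiteCoeff_smul]
  rfl

end Representation

end Literature.Analysis.SegalBargmann

end
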